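import Literature.NumberTheory.Transcendental.PhilipponCriterionCut
import HarnessLib

/-!
# Philippon's criterion over Nesterenko's toolkit, VIII: generators outside a prime, and descent to a point — proofs only

`Literature/NumberTheory/Transcendental/PhilipponCriterionDescend.lean` — proofs only (no new
definitions, nothing asserted). Two uses of the finiteness hypothesis of Philippon's criterion
(Publ. Math. IHÉS 64 (1986), Thm 2.11: the ideal `I_M` has only finitely many zeros in the ball
`B(θ, e^{−R(M)})`) in its proof (§3):

* `exists_not_mem_of_finite_zeros` — (proof of Lemme 2.14, p. 43: "`X_{N,r} ⊄ 𝒵(I_M)` et donc il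
  existe un des générateurs de `I_M`, soit `Q`, tel que `ʰQ ∉ 𝔓_{N,r}`") if a homogeneous prime `𝔓`
  of rank `≥ 2` (dimension `≥ 1`) has a zero `(1 : z)` with `z` in the OPEN polydisc and the common
  zeros of the polynomials `E_j` in the closed polydisc are finite, some `E_j ∉ 𝔓` — by the absence
  of isolated points (`infinite_projZeros_near`, `ProjectiveNoIsolatedPoints.lean`);
* `descent_to_point` — (proof of Lemme 2.15, pp. 46–47, the rôle of Prop. 2.6: "`𝔓` est un idéal
  premier minimal associé à `(𝔓, ʰQ₁^{(M−1)}, …, ʰQ_m^{(M−1)})` … il suit de la proposition (2.6)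
  que `Ht(𝔓) ≤ …`, `Deg(𝔓) ≤ …`") starting from a homogeneous prime `𝔓₀` of rank `r₀` through a
  point `(1 : z)` at which all `E_j` vanish, `z` in the open polydisc, one cuts `j < r₀` times by
  generators outside the current prime (previous lemma) keeping the component through `(1 : z)`
  (`cut_component_facts`, `PhilipponCriterionCut.lean`), with the Bézout bookkeeping
  `deg ≤ deg 𝔓₀ · Dⁿʲ`, `h ≤ h(𝔓₀) Dʲ + j c D₀ Dʲ⁻¹`, `c = σ' + (m(r₀+1) + m²) D`.

## References

* [Philippon1986Criteres] P. Philippon, Publ. Math. IHÉS 64 (1986), §3, pp. 43 and 46–47;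
  Prop. 2.6 (p. 34).
* [NesterenkoPhilippon2001] LNM 1752 (2001), Ch. 3 Prop. 4.7, Prop. 4.11 (pp. 39–41).
-/

noncomputable section

open MvPolynomial
open Literature.NumberTheory.Transcendental.Nesterenko

attribute [local instance] MvPolynomial.gradedAlgebra

namespace Literature.NumberTheory.Transcendental

namespace PhilipponMain

variable {m : ℕ}

/-! ### A generator outside the prime -/

/-- **Some generator does not vanish on `V(𝔓)`** (Philippon 1986, proof of Lemme 2.14, p. 43). Let
`𝔓` be a homogeneous prime of rank `r ≥ 2`, `(1 : z) ∈ V(𝔓)` with `max |z_i − θ_i| < ρ₀`, and let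
`E_j` (`j ∈ ι`, finite) be polynomials whose common zeros `(1 : z')` with `max |z'_i − θ_i| ≤ ρ₀` are
finite in number. Then some `E_j ∉ 𝔓`: otherwise every point of `V(𝔓)` in the polydisc would be a
common zero, and there are infinitely many (`infinite_projZeros_near`).
[cite: Philippon1986Criteres, §3 p. 43 (proof of Lemme 2.14)] -/
theorem exists_not_mem_of_finite_zeros {ι : Type*} [Finite ι] {r : ℕ} (hr : 2 ≤ r) {𝔓 : Ideal (Rx m)}
    (h𝔓 : 𝔓.IsPrime) (h𝔓hom : 𝔓.IsHomogeneous (homogeneousSubmodule (Fin (m + 1)) ℚ))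
    (h𝔓unm : IsUnmixedOfRank 𝔓 r) (θ : Fin m → ℂ) {ρ₀ : ℝ} (E : ι → Rx m)
    (hfin : Set.Finite {z : Fin m → ℂ | (∀ i, ‖z i - θ i‖ ≤ ρ₀) ∧
      ∀ j, aeval (Fin.cons 1 z : Fin (m + 1) → ℂ) (E j) = 0})
    {z : Fin m → ℂ} (hz : (Fin.cons 1 z : Fin (m + 1) → ℂ) ∈ projZeros 𝔓) (hzθ : ∀ i, ‖z i - θ i‖ < ρ₀)
    (hρ₀ : 0 < ρ₀) : ∃ j, E j ∉ 𝔓 := by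
  by_contra hall
  push Not at hall
  -- room left in the polydisc around `z`
  obtain ⟨ε, hε, hεle⟩ : ∃ ε : ℝ, 0 < ε ∧ ∀ i, ‖z i - θ i‖ + ε ≤ ρ₀ := by
    by_cases hm : Nonempty (Fin m)
    · obtain ⟨i₀, -, hi₀⟩ := Finset.exists_mem_eq_sup' (Finset.univ_nonempty (α := Fin m))
        (fun i => ‖z i - θ i‖)
      refine ⟨ρ₀ - Finset.univ.sup' Finset.univ_nonempty (fun i => ‖z i - θ i‖), ?_, fun i => ?_⟩
      · rw [hi₀]; linarith [hzθ i₀]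
      · have : ‖z i - θ i‖ ≤ Finset.univ.sup' Finset.univ_nonempty (fun i => ‖z i - θ i‖) :=
          Finset.le_sup' (fun i => ‖z i - θ i‖) (Finset.mem_univ i)
        linarith
    · exact ⟨ρ₀, hρ₀, fun i => absurd ⟨i⟩ hm⟩
  have hinf := infinite_projZeros_near hr h𝔓 ((fun g hg k => homogeneousComponent_mem_of_mem h𝔓hom hg k))
    h𝔓unm hz hε
  refine hinf (hfin.subset ?_)
  rintro z' ⟨hz'V, hz'ε⟩
  refine ⟨fun i => ?_, fun j => hz'V.2 _ (hall j)⟩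
  calc ‖z' i - θ i‖ ≤ ‖z' i - z i‖ + ‖z i - θ i‖ := norm_sub_le_norm_sub_add_norm_sub _ _ _
    _ ≤ ε + ‖z i - θ i‖ := by linarith [(hz'ε i).le]
    _ ≤ ρ₀ := by linarith [hεle i]

/-! ### Descent to a point along the components through it -/

/-- **Descent to a point** (the rôle of Philippon's Prop. 2.6 in the proof of Lemme 2.15, pp. 46–47).
Let `𝔓₀` be a homogeneous prime of rank `r₀` (`1 ≤ r₀ ≤ m`), `(1 : z) ∈ V(𝔓₀)` with
`max |z_i − θ_i| < ρ₀`, and `E_j` (`j ∈ ι` finite) homogeneous of degrees `d_j ≤ D` (`D ≥ 1`) and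
heights `≤ σ'`, all vanishing at `(1 : z)`, whose common zeros `(1 : z')`, `max |z'_i − θ_i| ≤ ρ₀`,
are finite in number. Then for every `j < r₀` there is a homogeneous prime `𝔔 ⊇ 𝔓₀` of rank
`r₀ − j` with `(1 : z) ∈ V(𝔔)`, `deg 𝔔 ≤ deg 𝔓₀ · Dʲ` and
`h(𝔔) ≤ h(𝔓₀) Dʲ + j · c · deg 𝔓₀ · Dʲ / D`, `c = σ' + (m(r₀+1) + m²) D` (cut `j` times by a
generator outside the current prime, keeping the component through the point).
[cite: Philippon1986Criteres, §3 pp. 46–47 (proof of Lemme 2.15) and Prop. 2.6]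
[cite: NesterenkoPhilippon2001, Ch. 3 Prop. 4.7, 4.11] -/
theorem descent_to_point (h47 : NesterenkoPhilippon2001_ch3_prop_4_7)
    (h411 : NesterenkoPhilippon2001_ch3_prop_4_11) {ι : Type*} [Finite ι] {r₀ : ℕ} (hr₀1 : 1 ≤ r₀)
    (hr₀m : r₀ ≤ m) {𝔓₀ : Ideal (Rx m)} (h𝔓₀ : 𝔓₀.IsPrime)
    (h𝔓₀hom : 𝔓₀.IsHomogeneous (homogeneousSubmodule (Fin (m + 1)) ℚ)) (h𝔓₀unm : IsUnmixedOfRank 𝔓₀ r₀)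
    (θ : Fin m → ℂ) {ρ₀ : ℝ} (hρ₀ : 0 < ρ₀) (E : ι → Rx m) (d : ι → ℕ)
    (hEhom : ∀ j, (E j).IsHomogeneous (d j)) {D σ' : ℝ} (hD1 : 1 ≤ D) (hσ' : 0 ≤ σ')
    (hdD : ∀ j, (d j : ℝ) ≤ D) (hhE : ∀ j, height (E j) ≤ σ')
    (hfin : Set.Finite {z : Fin m → ℂ | (∀ i, ‖z i - θ i‖ ≤ ρ₀) ∧
      ∀ j, aeval (Fin.cons 1 z : Fin (m + 1) → ℂ) (E j) = 0})
    {z : Fin m → ℂ} (hz : (Fin.cons 1 z : Fin (m + 1) → ℂ) ∈ projZeros 𝔓₀) (hzθ : ∀ i, ‖z i - θ i‖ < ρ₀)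
    (hzE : ∀ j, aeval (Fin.cons 1 z : Fin (m + 1) → ℂ) (E j) = 0) :
    ∀ j : ℕ, j < r₀ → ∃ 𝔔 : Ideal (Rx m), 𝔔.IsPrime ∧
      𝔔.IsHomogeneous (homogeneousSubmodule (Fin (m + 1)) ℚ) ∧ IsUnmixedOfRank 𝔔 (r₀ - j) ∧
      𝔓₀ ≤ 𝔔 ∧ (Fin.cons 1 z : Fin (m + 1) → ℂ) ∈ projZeros 𝔔 ∧
      (ideg 𝔔 (r₀ - j) : ℝ) ≤ ideg 𝔓₀ r₀ * D ^ j ∧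
      iheight 𝔔 (r₀ - j) ≤ iheight 𝔓₀ r₀ * D ^ j +
        j * (σ' + ((m : ℝ) * (r₀ + 1) + (m : ℝ) ^ 2) * D) * ideg 𝔓₀ r₀ * D ^ j / D := by
  classical
  set c : ℝ := σ' + ((m : ℝ) * (r₀ + 1) + (m : ℝ) ^ 2) * D with hc
  have hD0 : 0 < D := lt_of_lt_of_le one_pos hD1
  have hc0 : 0 ≤ c := by positivity
  intro j
  induction j with
  | zero =>
    intro _
    refine ⟨𝔓₀, h𝔓₀, h𝔓₀hom, by simpa using h𝔓₀unm, le_rfl, hz, ?_, ?_⟩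
    · simp
    · simp
  | succ j ih =>
    intro hj
    obtain ⟨𝔔, h𝔔, h𝔔hom, h𝔔unm, h𝔓₀𝔔, hz𝔔, hdeg𝔔, hh𝔔⟩ := ih (by omega)
    -- the current rank `r = r₀ - j ≥ 2`
    have hr2 : 2 ≤ r₀ - j := by omega
    have hrm : r₀ - j ≤ m := by omega
    -- a generator outside `𝔔`
    obtain ⟨i, hi⟩ := exists_not_mem_of_finite_zeros hr2 h𝔔 h𝔔hom h𝔔unm θ E hfin hz𝔔 hzθ hρ₀
    -- `d i ≥ 1`: `E i ≠ 0` vanishes at `(1 : z)`, so it is not a constant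
    have hdi : 1 ≤ d i := by
      by_contra hd0
      have hd0' : d i = 0 := by omega
      have hE0 : E i ≠ 0 := fun h => hi (h ▸ 𝔔.zero_mem)
      have h00 : (E i).totalDegree = 0 := by
        have := (hEhom i).totalDegree_le
        omega
      have hEC : E i = C (coeff 0 (E i)) := totalDegree_eq_zero_iff_eq_C.mp h00
      have hc0 : coeff 0 (E i) ≠ 0 := fun hc => hE0 (by rw [hEC, hc, C_0])
      apply hc0
      have h2 := hzE i
      rw [hEC, aeval_C] at h2
      exact (map_eq_zero_iff _ (algebraMap ℚ ℂ).injective).mp h2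
    -- Prop. 4.11's `J'` for `(𝔔, E i)` and the component through `(1 : z)`
    obtain ⟨J', hJ'hom, hJ'unm, hJ'V, -, -, -⟩ :=
      (h411 m (r₀ - j) 𝔔 (E i) (d i) (by omega) hrm h𝔔 h𝔔hom h𝔔unm (hEhom i) hdi hi).1 hr2
    obtain ⟨t', ht'⟩ : ∃ t' : Finset (Ideal (Rx m)), Submodule.IsMinimalPrimaryDecomposition J' t' :=
      Submodule.IsLasker.exists_isMinimalPrimaryDecomposition (Submodule.isLasker (Rx m) (Rx m)) J'
    have hzJ' : (Fin.cons 1 z : Fin (m + 1) → ℂ) ∈ projZeros J' := by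
      rw [hJ'V, projZeros_sup, projZeros_span_singleton]
      exact ⟨hz𝔔, hz𝔔.1, hzE i⟩
    have hzU : (Fin.cons 1 z : Fin (m + 1) → ℂ) ∈ ⋃ Q ∈ t', projZeros Q.radical := by
      rw [← projZeros_eq_biUnion_radical ht'.inf_eq]; exact hzJ'
    obtain ⟨Q, hQ, hzQ⟩ := Set.mem_iUnion₂.mp hzU
    obtain ⟨hQprime, hQhom, hQunm, -, -⟩ :=
      Literature.Barriers.Schanuel.radical_component_facts hJ'hom hJ'unm ht' hQ
    obtain ⟨h𝔔Q, -, hdegQ, hhQ⟩ := cut_component_facts h47 h411 hr2 hrm h𝔔 h𝔔hom h𝔔unm (hEhom i) hi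
      hJ'hom hJ'unm hJ'V ht' hQ ⟨_, hzQ⟩
    have hrank : r₀ - (j + 1) = r₀ - j - 1 := by omega
    refine ⟨Q.radical, hQprime, hQhom, by rwa [hrank], h𝔓₀𝔔.trans h𝔔Q, hzQ, ?_, ?_⟩
    · -- degree
      rw [hrank]
      have h1 : (ideg Q.radical (r₀ - j - 1) : ℝ) ≤ (ideg 𝔔 (r₀ - j) : ℝ) * d i := by
        exact_mod_cast hdegQ
      have hdeg0 : (0 : ℝ) ≤ ideg 𝔔 (r₀ - j) := Nat.cast_nonneg _
      calc (ideg Q.radical (r₀ - j - 1) : ℝ) ≤ (ideg 𝔔 (r₀ - j) : ℝ) * d i := h1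
        _ ≤ (ideg 𝔓₀ r₀ * D ^ j) * D := mul_le_mul hdeg𝔔 (hdD i) (Nat.cast_nonneg _) (by positivity)
        _ = ideg 𝔓₀ r₀ * D ^ (j + 1) := by ring
    · -- height
      rw [hrank]
      have hdeg0 : (0 : ℝ) ≤ ideg 𝔔 (r₀ - j) := Nat.cast_nonneg _
      have hh0 : 0 ≤ iheight 𝔔 (r₀ - j) := height_nonneg _
      have hE0 : 0 ≤ height (E i) := height_nonneg _
      have hdi0 : (0 : ℝ) ≤ d i := Nat.cast_nonneg _
      have hr : ((r₀ - j : ℕ) : ℝ) + 1 ≤ (r₀ : ℝ) + 1 := by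
        have : ((r₀ - j : ℕ) : ℝ) ≤ r₀ := by exact_mod_cast Nat.sub_le r₀ j
        linarith
      -- `h(√Q) ≤ h(𝔔) d + σ' deg 𝔔 + (m(r+1)+m²) deg 𝔔 d ≤ h(𝔔) D + c deg 𝔔`
      have h1 : iheight Q.radical (r₀ - j - 1) ≤ iheight 𝔔 (r₀ - j) * D + c * ideg 𝔔 (r₀ - j) := by
        refine hhQ.trans ?_
        have e1 : iheight 𝔔 (r₀ - j) * (d i : ℝ) ≤ iheight 𝔔 (r₀ - j) * D :=
          mul_le_mul_of_nonneg_left (hdD i) hh0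
        have e2 : height (E i) * (ideg 𝔔 (r₀ - j) : ℝ) ≤ σ' * ideg 𝔔 (r₀ - j) :=
          mul_le_mul_of_nonneg_right (hhE i) hdeg0
        have e3 : ((m : ℝ) * ((r₀ - j : ℕ) + 1) + (m : ℝ) ^ 2) * ideg 𝔔 (r₀ - j) * d i ≤
            ((m : ℝ) * (r₀ + 1) + (m : ℝ) ^ 2) * ideg 𝔔 (r₀ - j) * D := by
          apply mul_le_mul _ (hdD i) hdi0 (by positivity)
          exact mul_le_mul_of_nonneg_right (by nlinarith [(Nat.cast_nonneg m : (0 : ℝ) ≤ m)]) hdeg0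
        have e4 : ((m : ℝ) * (r₀ + 1) + (m : ℝ) ^ 2) * ideg 𝔔 (r₀ - j) * D =
            (((m : ℝ) * (r₀ + 1) + (m : ℝ) ^ 2) * D) * ideg 𝔔 (r₀ - j) := by ring
        rw [hc]
        nlinarith [e1, e2, e3, e4]
      -- plug in the inductive bounds
      have hDj : D ^ j = D ^ (j + 1) / D := by
        rw [pow_succ, mul_div_assoc, div_self hD0.ne', mul_one]
      calc iheight Q.radical (r₀ - j - 1) ≤ iheight 𝔔 (r₀ - j) * D + c * ideg 𝔔 (r₀ - j) := h1
        _ ≤ (iheight 𝔓₀ r₀ * D ^ j + j * c * ideg 𝔓₀ r₀ * D ^ j / D) * D +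
              c * (ideg 𝔓₀ r₀ * D ^ j) := by
            apply add_le_add (mul_le_mul_of_nonneg_right hh𝔔 hD0.le)
              (mul_le_mul_of_nonneg_left hdeg𝔔 hc0)
        _ = iheight 𝔓₀ r₀ * D ^ (j + 1) +
              ((j + 1 : ℕ) : ℝ) * c * ideg 𝔓₀ r₀ * D ^ (j + 1) / D := by
            push_cast
            field_simp
            ring

end PhilipponMain

end Literature.NumberTheory.Transcendental

end
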